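import Summits.Ventures.HodgeRepro.Tier3WedgeRestrictScalars

/-!
# The Weil line lies in the Künneth component — §4(b)'s «`W_F(B) ⊂ K`» on the kernel, and `act` is additive there

Blind re-derivation cell `pub-hodge-repro`, seat `t3-p4` (Tier 3, T3.5 for T3.4 = Lemma R).  Target tree path
`lean/Summits/Ventures/HodgeRepro/Tier3WeilLineKunneth.lean`; imports the cell's `Tier3WedgeRestrictScalars` (for
`lineSet`, the enumeration lemma `snd_ofFinEmbEquiv_symm_eq_of_lineSet`, and — transitively — `Tier3OrbitDescent`'s
`subspace_le_of_baseChange_le`).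

WHAT THIS FILE STATES (LEMMA-R-RESIDUE.md §4(b), last sentence: «In particular `W_F(B) ⊂ K` (M1's footnote: a
`ℚ`-subspace is determined by its complexification)», with `K := ⊗_i H¹(A_{T_i}, ℚ) ⊂ H^{2p}(B, ℚ)` the Künneth
component of §3; and §4(d)'s «`act(a) := α(a, 1, …, 1)^*` restricted to `K` … is `ℚ`-linear and additive and
multiplicative in `a`»).  On the kernel `V = H¹(B, ℚ)` is a `K`-space with `K`-basis `ω′ : ι → V` (one generator per
corner; `K = F`, `F₀ = ℚ`), the corner `H¹(A_{T_i}, ℚ)` is the line `K · ω′ᵢ`, and the Künneth component is stated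
WITHOUT a definition as the `F₀`-span of the wedges with exactly one vector from each corner:
`span_{F₀} {c₁ ω′_{e 1} ∧ ⋯ ∧ cₙ ω′_{e n} : c : Fin n → K, e : Fin n → ι bijective}` (`n = |ι|`).

* `constr_update_zero_one_apply` — the diagonal operator `A′ b` at the indicator vector `b = (1 at i, 0 elsewhere)` is
  the projection onto the corner line: `A′ b v = (ω′.repr v i) • ω′ᵢ`;
* `symm_ιMulti_mem_baseChange_kunneth_of_corner` — a wedge `x₁ ∧_K ⋯ ∧ xₙ` in `⋀[K]^n (K ⊗ V)` of vectors each fixed by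
  the corner projection `1 ⊗ A′ (1 at f t, 0 elsewhere)` lies, through `Φ′⁻¹`, in the base change of the Künneth span
  of `f` (`Module.Basis.ext_multilinear` on the base change of an `F₀`-basis of `V`: on pure tensors `1 ⊗ βⱼ` the wedge
  is `Φ′ (1 ⊗ (A′ b₁ β_{j₁} ∧_{F₀} ⋯))`, a Künneth wedge);
* `weil_line_le_kunneth` — **§4(b)'s `W_F ⊂ K`**: on the data of the kernel twins (`W_F ⊗ K = span{E′_L : L a line}`,
  `Φ′ E′_L = ∧ e′(enum L)`, the diagonal eigen-relation `(1 ⊗ A′ b) e′(i, σ) = σ(bᵢ) • e′(i, σ)`), every `e′(i, σ)` is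
  fixed by the corner projection (`b` the indicator of `i`: `σ(1) = 1`), the line `L_σ = {(i, σ)}` enumerates the
  corners bijectively, so `E′_{L_σ}` lies in the base change of the Künneth span, hence `W_F ⊗ K ≤ K_{Künneth} ⊗ K`, and
  Milne's footnote (`subspace_le_of_baseChange_le`) gives `W_F ≤ K_{Künneth}`;
* `weil_act_ιMulti_kunneth` — on a Künneth wedge `act(a) = ⋀^n(A′ (a at i₀, 1 elsewhere))` multiplies the one slot of the
  corner `i₀` by `a` and nothing else;
* `weil_act_add_of_mem_kunneth` / `weil_act_zero_of_mem_kunneth` — **`act(a + b) = act(a) + act(b)` and `act(0) = 0` on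
  the whole Künneth component** (`AlternatingMap.map_update_add` / `map_update_zero` in that slot, then the span);
* `weil_act_add_of_mem_of_le_kunneth` / `weil_act_zero_of_mem_of_le_kunneth` — the same on any `W_F ≤ K_{Künneth}`: the
  paper's own derivation of the additivity on `W_F` (§4(d): «restricted to `K` … additive», then `W_F ⊂ K`), with no
  use of `q` — the hypotheses «`q` injective on `W_F`» and «`W_F` `act`-stable» of `Tier3WeilLineModule.weil_act_add_of_mem`
  are replaced by the inclusion;
* `weil_line_act_add_of_data` — the two combined on the kernel twins' data: additivity of `act` on `W_F` from the
  eigenbasis alone.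

HONESTY.  The kernel model carries `W_F` inside `⋀[F₀]^n V` directly and no consumer of the lane needs the inclusion
(`act` is defined on all of `⋀[F₀]^n V`); this file is a LABEL — the last untwinned sentence of §4(b), and the reason
§4(d) says «restricted to `K`» (`act(a)` has degree two in `a` on a wedge with two vectors of one corner, so it is not
additive off the Künneth component — `Tier3WeilLineModule`'s HONESTY paragraph).  Linear algebra on the cell's own
modules and Mathlib; no definition, instance or notation is introduced; nothing geometric is built.  Nothing mathematical
moves (LEMMA-R-RESIDUE: residue 0 unchanged).  HC_CM is NOT proved by anyone in this repository.
-/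

set_option autoImplicit false

open TensorProduct Finset

namespace HodgeRepro.Tier3

open HodgeRepro.RouteC

/-! ### §1 The corner projection -/

section CornerProjection

variable {F₀ K : Type*} [Field F₀] [Field K] [Algebra F₀ K]
variable {V : Type*} [AddCommGroup V] [Module K V] [Module F₀ V] [IsScalarTower F₀ K V]
variable {ι : Type*} [DecidableEq ι]

/-- **The diagonal operator at an indicator vector is the corner projection**: `A′ (1 at i, 0 elsewhere) v =
(ω′.repr v i) • ω′ᵢ` (`A′ b = (ω′ⱼ ↦ bⱼ • ω′ⱼ)` as in `Tier3LemmaRGenerator` / `Tier3LemmaRCorrespondence`). -/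
theorem constr_update_zero_one_apply (ω' : Module.Basis ι K V) (i : ι) (v : V) :
    (ω'.constr K fun j => Function.update (fun _ => (0 : K)) i (1 : K) j • ω' j) v =
      ω'.repr v i • ω' i := by
  have h : (ω'.constr K fun j => Function.update (fun _ => (0 : K)) i (1 : K) j • ω' j) =
      (ω'.coord i).smulRight (ω' i) := by
    refine ω'.ext fun j => ?_
    rw [Module.Basis.constr_basis, LinearMap.smulRight_apply, Module.Basis.coord_apply,
      Module.Basis.repr_self, Finsupp.single_apply]
    by_cases hji : j = i
    · subst hji
      rw [Function.update_self, if_pos rfl]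
    · rw [Function.update_of_ne hji, if_neg hji, zero_smul, zero_smul]
  rw [h, LinearMap.smulRight_apply, Module.Basis.coord_apply]

end CornerProjection

/-! ### §2 Wedges of corner vectors lie in the base change of the Künneth span -/

section Kunneth

variable {F₀ K : Type*} [Field F₀] [Field K] [Algebra F₀ K]
variable {V : Type*} [AddCommGroup V] [Module K V] [Module F₀ V] [IsScalarTower F₀ K V]
variable {ι : Type*} [DecidableEq ι]

/-- **A wedge of corner vectors, through `Φ′⁻¹`, lies in the base change of the Künneth span.**  If every slot `x t` of
a wedge in `⋀[K]^n (K ⊗ V)` is fixed by the corner projection `1 ⊗ A′ (1 at f t, 0 elsewhere)`, then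
`Φ′⁻¹ (x₁ ∧ ⋯ ∧ xₙ) ∈ (span_{F₀} {c₁ ω′_{f 1} ∧_{F₀} ⋯ ∧ cₙ ω′_{f n}}) ⊗ K`.  Proof: the `K`-multilinear map
`(y₁, …, yₙ) ↦ Φ′⁻¹ ((1 ⊗ A′ b₁) y₁ ∧ ⋯ ∧ (1 ⊗ A′ bₙ) yₙ)` takes every value in that base change — on the pure tensors
`1 ⊗ βⱼ` of a base-changed `F₀`-basis it is `Φ′⁻¹ Φ′ (1 ⊗ (A′ b₁ β_{j₁} ∧_{F₀} ⋯))`, a Künneth wedge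
(`Module.Basis.ext_multilinear` against the quotient by the base change) — and at `y = x` it is `Φ′⁻¹ (x₁ ∧ ⋯ ∧ xₙ)`. -/
theorem symm_ιMulti_mem_baseChange_kunneth_of_corner (n : ℕ) (ω' : Module.Basis ι K V)
    (Φ' : K ⊗[F₀] ⋀[F₀]^n V ≃ₗ[K] ⋀[K]^n (K ⊗[F₀] V))
    (hΦ' : ∀ (c : K) (w : Fin n → V),
      Φ' (c ⊗ₜ[F₀] exteriorPower.ιMulti F₀ n w) = c • exteriorPower.ιMulti K n (fun i => (1 : K) ⊗ₜ[F₀] w i))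
    (f : Fin n → ι) (x : Fin n → K ⊗[F₀] V)
    (hx : ∀ t, LinearMap.lTensor K
      ((ω'.constr K fun j => Function.update (fun _ => (0 : K)) (f t) (1 : K) j • ω' j).restrictScalars F₀)
        (x t) = x t) :
    Φ'.symm (exteriorPower.ιMulti K n x) ∈
      (Submodule.span F₀ {w : ⋀[F₀]^n V | ∃ c : Fin n → K,
        w = exteriorPower.ιMulti F₀ n (fun t => c t • ω' (f t))}).baseChange K := by
  classical
  set Q := (Submodule.span F₀ {w : ⋀[F₀]^n V | ∃ c : Fin n → K,
    w = exteriorPower.ιMulti F₀ n (fun t => c t • ω' (f t))}).baseChange K with hQ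
  set P : Fin n → (V →ₗ[F₀] V) := fun t =>
    (ω'.constr K fun j => Function.update (fun _ => (0 : K)) (f t) (1 : K) j • ω' j).restrictScalars F₀ with hP
  -- the `K`-multilinear map `(y₁, …, yₙ) ↦ Φ′⁻¹ ((1 ⊗ P₁) y₁ ∧ ⋯ ∧ (1 ⊗ Pₙ) yₙ)`
  let h : MultilinearMap K (fun _ : Fin n => K ⊗[F₀] V) (K ⊗[F₀] ⋀[F₀]^n V) :=
    Φ'.symm.toLinearMap.compMultilinearMap
      ((exteriorPower.ιMulti K n).toMultilinearMap.compLinearMap (fun t => (P t).baseChange K))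
  have hQ_all : ∀ y : Fin n → K ⊗[F₀] V, h y ∈ Q := by
    have hzero : Q.mkQ.compMultilinearMap h = 0 := by
      let β := Module.Free.chooseBasis F₀ V
      refine Module.Basis.ext_multilinear (fun _ => β.baseChange K) fun v => ?_
      simp only [h, LinearMap.compMultilinearMap_apply, MultilinearMap.compLinearMap_apply,
        AlternatingMap.coe_multilinearMap, Module.Basis.baseChange_apply, LinearMap.baseChange_tmul,
        LinearEquiv.coe_coe, Submodule.mkQ_apply, zero_apply, Submodule.Quotient.mk_eq_zero]
      have h1 : exteriorPower.ιMulti K n (fun t => (1 : K) ⊗ₜ[F₀] P t (β (v t))) =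
          Φ' ((1 : K) ⊗ₜ[F₀] exteriorPower.ιMulti F₀ n (fun t => P t (β (v t)))) := by
        rw [hΦ', one_smul]
      rw [h1, LinearEquiv.symm_apply_apply]
      refine Submodule.tmul_mem_baseChange_of_mem 1
        (Submodule.subset_span ⟨fun t => ω'.repr (β (v t)) (f t), ?_⟩)
      have h2 : (fun t => P t (β (v t))) = fun t => ω'.repr (β (v t)) (f t) • ω' (f t) := by
        funext t
        simp only [hP, LinearMap.coe_restrictScalars]
        exact constr_update_zero_one_apply ω' (f t) (β (v t))
      rw [h2]
    intro y
    have hy := MultilinearMap.congr_fun hzero y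
    rw [LinearMap.compMultilinearMap_apply, zero_apply, Submodule.mkQ_apply,
      Submodule.Quotient.mk_eq_zero] at hy
    exact hy
  have hhx : h x = Φ'.symm (exteriorPower.ιMulti K n x) := by
    have h3 : (fun t => (P t).baseChange K (x t)) = x := by
      funext t
      rw [LinearMap.baseChange_eq_ltensor]
      exact hx t
    simp only [h, LinearMap.compMultilinearMap_apply, MultilinearMap.compLinearMap_apply,
      AlternatingMap.coe_multilinearMap, LinearEquiv.coe_coe]
    rw [h3]
  rw [← hhx]
  exact hQ_all x

end Kunneth

/-! ### §3 The Weil line lies in the Künneth component -/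

section WeilLine

variable {F₀ K : Type*} [Field F₀] [Field K] [Algebra F₀ K]
variable {V : Type*} [AddCommGroup V] [Module K V] [Module F₀ V] [IsScalarTower F₀ K V]
variable {ι : Type*} [Fintype ι] [DecidableEq ι] [DecidableEq (K ≃ₐ[F₀] K)]

/-- **§4(b): the Weil line lies in the Künneth component.**  On the data of the kernel twins — the eigenbasis `e′` with
the diagonal eigen-relation `(1 ⊗ A′ b) e′(i, x) = x(bᵢ) • e′(i, x)`, the base change `Φ′`, the wedge basis `E′` with
`Φ′ E′_L = ∧ e′(enum L)`, and `W_F ⊗ K = span{E′_L : L a line}` — `W_F ≤ span_{F₀} {c₁ ω′_{e 1} ∧ ⋯ ∧ cₙ ω′_{e n} :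
e bijective}`: at the indicator vector `b` of `i` the eigen-relation reads `(1 ⊗ A′ b) e′(i, σ) = σ(1) • e′(i, σ) =
e′(i, σ)`, so each `e′(i, σ)` is a corner vector; the line `L_σ = {(i, σ) : i ∈ ι}` enumerates the corners bijectively,
so `E′_{L_σ} = Φ′⁻¹ (∧_t e′(enum t))` lies in the base change of the Künneth span
(`symm_ιMulti_mem_baseChange_kunneth_of_corner`); hence `W_F ⊗ K ≤ K_{Künneth} ⊗ K`, and Milne's footnote
(`subspace_le_of_baseChange_le`) gives `W_F ≤ K_{Künneth}`. -/
theorem weil_line_le_kunneth {n : ℕ} (hn : Fintype.card ι = n) (ω' : Module.Basis ι K V)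
    [LinearOrder (ι × (K ≃ₐ[F₀] K))]
    (e' : Module.Basis (ι × (K ≃ₐ[F₀] K)) K (K ⊗[F₀] V))
    (E' : Module.Basis (Set.powersetCard (ι × (K ≃ₐ[F₀] K)) n) K (K ⊗[F₀] ⋀[F₀]^n V))
    (Φ' : K ⊗[F₀] ⋀[F₀]^n V ≃ₗ[K] ⋀[K]^n (K ⊗[F₀] V))
    (he2' : ∀ (x : K ≃ₐ[F₀] K) (i : ι) (b : ι → K),
      LinearMap.lTensor K ((ω'.constr K fun i => b i • ω' i).restrictScalars F₀) (e' (i, x)) =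
        x (b i) • e' (i, x))
    (hΦ' : ∀ (c : K) (w : Fin n → V),
      Φ' (c ⊗ₜ[F₀] exteriorPower.ιMulti F₀ n w) = c • exteriorPower.ιMulti K n (fun i => (1 : K) ⊗ₜ[F₀] w i))
    (hE' : ∀ s, Φ' (E' s) = exteriorPower.ιMulti_family K n e' s)
    (WF : Submodule F₀ (⋀[F₀]^n V))
    (hWF : WF.baseChange K =
      Submodule.span K (E' '' {L | ∃ σ : K ≃ₐ[F₀] K, (L : Finset (ι × (K ≃ₐ[F₀] K))) = lineSet σ})) :
    WF ≤ Submodule.span F₀ {w : ⋀[F₀]^n V | ∃ (c : Fin n → K) (e : Fin n → ι), Function.Bijective e ∧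
      w = exteriorPower.ιMulti F₀ n (fun t => c t • ω' (e t))} := by
  classical
  refine subspace_le_of_baseChange_le (K := K) ?_
  rw [hWF, Submodule.span_le]
  rintro _ ⟨L, ⟨σ, hL⟩, rfl⟩
  -- the enumeration of the line `L = {(i, σ)}`: its first coordinates run through the corners bijectively
  set enum : Fin n ↪o (ι × (K ≃ₐ[F₀] K)) := Set.powersetCard.ofFinEmbEquiv.symm L with henum
  set f : Fin n → ι := fun t => (enum t).1 with hf
  have hsnd : ∀ t, (enum t).2 = σ := fun t => snd_ofFinEmbEquiv_symm_eq_of_lineSet L σ hL t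
  have hpair : ∀ t, enum t = (f t, σ) := fun t => Prod.ext rfl (hsnd t)
  have hfinj : Function.Injective f := by
    intro t₁ t₂ h
    apply enum.injective
    rw [hpair t₁, hpair t₂, h]
  have hfbij : Function.Bijective f :=
    (Fintype.bijective_iff_injective_and_card f).mpr ⟨hfinj, by rw [Fintype.card_fin, hn]⟩
  -- `E′_L = Φ′⁻¹ (∧_t e′(f t, σ))`
  have hEL : E' L = Φ'.symm (exteriorPower.ιMulti K n (fun t => e' (f t, σ))) := by
    rw [← LinearEquiv.symm_apply_apply Φ' (E' L), hE']
    congr 1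
    show exteriorPower.ιMulti K n (e' ∘ enum) = _
    congr 1
    funext t
    rw [Function.comp_apply, hpair t]
  -- each `e′(i, σ)` is fixed by the corner projection of `i`
  have hx : ∀ t, LinearMap.lTensor K
      ((ω'.constr K fun j => Function.update (fun _ => (0 : K)) (f t) (1 : K) j • ω' j).restrictScalars F₀)
        (e' (f t, σ)) = e' (f t, σ) := by
    intro t
    rw [he2' σ (f t) (Function.update (fun _ => (0 : K)) (f t) (1 : K)), Function.update_self, map_one,
      one_smul]
  have hmem := symm_ιMulti_mem_baseChange_kunneth_of_corner n ω' Φ' hΦ' f (fun t => e' (f t, σ)) hx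
  rw [SetLike.mem_coe, hEL]
  refine Submodule.baseChange_mono K (Submodule.span_mono ?_) hmem
  rintro _ ⟨c, rfl⟩
  exact ⟨c, f, hfbij, rfl⟩

end WeilLine

/-! ### §4 `act` is additive on the Künneth component -/

section ActOnKunneth

variable {F₀ K : Type*} [Field F₀] [Field K] [Algebra F₀ K]
variable {V : Type*} [AddCommGroup V] [Module K V] [Module F₀ V] [IsScalarTower F₀ K V]
variable {ι : Type*} [DecidableEq ι]

/-- **On a Künneth wedge, `act(a)` multiplies the one slot of the corner `i₀` by `a`**: for `e` injective with
`e t₀ = i₀`, `⋀^n(A′ (a at i₀, 1 elsewhere)) (∧_t c_t ω′_{e t}) = ∧_t (update (c • ω′ ∘ e) t₀ (a • c_{t₀} ω′_{i₀}))`. -/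
theorem weil_act_ιMulti_kunneth (n : ℕ) (ω' : Module.Basis ι K V) (i₀ : ι) (a : K)
    (c : Fin n → K) (e : Fin n → ι) (he : Function.Injective e) (t₀ : Fin n) (ht₀ : e t₀ = i₀) :
    exteriorPower.map n
        ((ω'.constr K fun i => Function.update (fun _ => (1 : K)) i₀ a i • ω' i).restrictScalars F₀)
        (exteriorPower.ιMulti F₀ n (fun t => c t • ω' (e t))) =
      exteriorPower.ιMulti F₀ n (Function.update (fun t => c t • ω' (e t)) t₀ (a • (c t₀ • ω' i₀))) := by
  classical
  rw [exteriorPower.map_apply_ιMulti]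
  congr 1
  funext t
  simp only [Function.comp_apply, LinearMap.coe_restrictScalars, map_smul, Module.Basis.constr_basis]
  by_cases ht : t = t₀
  · subst ht
    rw [Function.update_self, ht₀, Function.update_self, smul_comm]
  · have hne : e t ≠ i₀ := fun h => ht (he (h.trans ht₀.symm))
    simp only [Function.update_of_ne ht, Function.update_of_ne hne, one_smul]

/-- **`act(a + b) = act(a) + act(b)` on the Künneth component** (§4(d): «restricted to `K` … additive in `a`»): on a
Künneth wedge both sides are the wedge with the slot of the corner `i₀` multiplied by `a + b`, resp. `a` and `b`
(`AlternatingMap.map_update_add`); the `F₀`-linear map `act(a + b) − act(a) − act(b)` therefore vanishes on the span. -/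
theorem weil_act_add_of_mem_kunneth (n : ℕ) (ω' : Module.Basis ι K V) (i₀ : ι) (a b : K)
    (w : ⋀[F₀]^n V)
    (hw : w ∈ Submodule.span F₀ {w : ⋀[F₀]^n V | ∃ (c : Fin n → K) (e : Fin n → ι), Function.Bijective e ∧
      w = exteriorPower.ιMulti F₀ n (fun t => c t • ω' (e t))}) :
    exteriorPower.map n
        ((ω'.constr K fun i => Function.update (fun _ => (1 : K)) i₀ (a + b) i • ω' i).restrictScalars F₀) w =
      exteriorPower.map n
        ((ω'.constr K fun i => Function.update (fun _ => (1 : K)) i₀ a i • ω' i).restrictScalars F₀) w +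
      exteriorPower.map n
        ((ω'.constr K fun i => Function.update (fun _ => (1 : K)) i₀ b i • ω' i).restrictScalars F₀) w := by
  classical
  set D : ⋀[F₀]^n V →ₗ[F₀] ⋀[F₀]^n V :=
    exteriorPower.map n
        ((ω'.constr K fun i => Function.update (fun _ => (1 : K)) i₀ (a + b) i • ω' i).restrictScalars F₀) -
      (exteriorPower.map n
        ((ω'.constr K fun i => Function.update (fun _ => (1 : K)) i₀ a i • ω' i).restrictScalars F₀) +
       exteriorPower.map n
        ((ω'.constr K fun i => Function.update (fun _ => (1 : K)) i₀ b i • ω' i).restrictScalars F₀)) with hD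
  have hker : Submodule.span F₀ {w : ⋀[F₀]^n V | ∃ (c : Fin n → K) (e : Fin n → ι), Function.Bijective e ∧
      w = exteriorPower.ιMulti F₀ n (fun t => c t • ω' (e t))} ≤ LinearMap.ker D := by
    rw [Submodule.span_le]
    rintro _ ⟨c, e, hbij, rfl⟩
    obtain ⟨t₀, ht₀⟩ := hbij.surjective i₀
    rw [SetLike.mem_coe, LinearMap.mem_ker, hD, LinearMap.sub_apply, LinearMap.add_apply,
      weil_act_ιMulti_kunneth n ω' i₀ (a + b) c e hbij.injective t₀ ht₀,
      weil_act_ιMulti_kunneth n ω' i₀ a c e hbij.injective t₀ ht₀,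
      weil_act_ιMulti_kunneth n ω' i₀ b c e hbij.injective t₀ ht₀,
      add_smul, AlternatingMap.map_update_add, sub_self]
  have h0 := hker hw
  rw [LinearMap.mem_ker, hD, LinearMap.sub_apply, LinearMap.add_apply] at h0
  exact sub_eq_zero.mp h0

/-- **`act(0) = 0` on the Künneth component**: the slot of the corner `i₀` becomes `0`
(`AlternatingMap.map_update_zero`). -/
theorem weil_act_zero_of_mem_kunneth (n : ℕ) (ω' : Module.Basis ι K V) (i₀ : ι) (w : ⋀[F₀]^n V)
    (hw : w ∈ Submodule.span F₀ {w : ⋀[F₀]^n V | ∃ (c : Fin n → K) (e : Fin n → ι), Function.Bijective e ∧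
      w = exteriorPower.ιMulti F₀ n (fun t => c t • ω' (e t))}) :
    exteriorPower.map n
      ((ω'.constr K fun i => Function.update (fun _ => (1 : K)) i₀ (0 : K) i • ω' i).restrictScalars F₀) w = 0 := by
  classical
  have hker : Submodule.span F₀ {w : ⋀[F₀]^n V | ∃ (c : Fin n → K) (e : Fin n → ι), Function.Bijective e ∧
      w = exteriorPower.ιMulti F₀ n (fun t => c t • ω' (e t))} ≤ LinearMap.ker (exteriorPower.map n
        ((ω'.constr K fun i => Function.update (fun _ => (1 : K)) i₀ (0 : K) i • ω' i).restrictScalars F₀)) := by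
    rw [Submodule.span_le]
    rintro _ ⟨c, e, hbij, rfl⟩
    obtain ⟨t₀, ht₀⟩ := hbij.surjective i₀
    rw [SetLike.mem_coe, LinearMap.mem_ker, weil_act_ιMulti_kunneth n ω' i₀ 0 c e hbij.injective t₀ ht₀,
      zero_smul, AlternatingMap.map_update_zero]
  exact LinearMap.mem_ker.mp (hker hw)

/-- The paper's route to §4(d)'s additivity on `W_F`: `act(a + b) = act(a) + act(b)` on any `W_F ≤ K_{Künneth}`
(no `q`, no injectivity, no `act`-stability hypothesis). -/
theorem weil_act_add_of_mem_of_le_kunneth (n : ℕ) (ω' : Module.Basis ι K V) (i₀ : ι)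
    (WF : Submodule F₀ (⋀[F₀]^n V))
    (hK : WF ≤ Submodule.span F₀ {w : ⋀[F₀]^n V | ∃ (c : Fin n → K) (e : Fin n → ι), Function.Bijective e ∧
      w = exteriorPower.ιMulti F₀ n (fun t => c t • ω' (e t))})
    (a b : K) (w : ⋀[F₀]^n V) (hw : w ∈ WF) :
    exteriorPower.map n
        ((ω'.constr K fun i => Function.update (fun _ => (1 : K)) i₀ (a + b) i • ω' i).restrictScalars F₀) w =
      exteriorPower.map n
        ((ω'.constr K fun i => Function.update (fun _ => (1 : K)) i₀ a i • ω' i).restrictScalars F₀) w +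
      exteriorPower.map n
        ((ω'.constr K fun i => Function.update (fun _ => (1 : K)) i₀ b i • ω' i).restrictScalars F₀) w :=
  weil_act_add_of_mem_kunneth n ω' i₀ a b w (hK hw)

/-- The same for `act(0) = 0` on any `W_F ≤ K_{Künneth}`. -/
theorem weil_act_zero_of_mem_of_le_kunneth (n : ℕ) (ω' : Module.Basis ι K V) (i₀ : ι)
    (WF : Submodule F₀ (⋀[F₀]^n V))
    (hK : WF ≤ Submodule.span F₀ {w : ⋀[F₀]^n V | ∃ (c : Fin n → K) (e : Fin n → ι), Function.Bijective e ∧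
      w = exteriorPower.ιMulti F₀ n (fun t => c t • ω' (e t))})
    (w : ⋀[F₀]^n V) (hw : w ∈ WF) :
    exteriorPower.map n
      ((ω'.constr K fun i => Function.update (fun _ => (1 : K)) i₀ (0 : K) i • ω' i).restrictScalars F₀) w = 0 :=
  weil_act_zero_of_mem_kunneth n ω' i₀ w (hK hw)

end ActOnKunneth

/-! ### §5 Additivity of `act` on the Weil line from the eigenbasis alone -/

section Combined

variable {F₀ K : Type*} [Field F₀] [Field K] [Algebra F₀ K]
variable {V : Type*} [AddCommGroup V] [Module K V] [Module F₀ V] [IsScalarTower F₀ K V]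
variable {ι : Type*} [Fintype ι] [DecidableEq ι] [DecidableEq (K ≃ₐ[F₀] K)]

/-- **§4(b) + §4(d) on the kernel twins' data**: `W_F ⊂ K_{Künneth}` and the additivity of `act` there give
`act(a + b) w = act(a) w + act(b) w` for `w ∈ W_F` — from the eigenbasis, `Φ′`, `E′` and `W_F ⊗ K = span{E′_L : L a line}`
alone. -/
theorem weil_line_act_add_of_data {n : ℕ} (hn : Fintype.card ι = n) (ω' : Module.Basis ι K V)
    [LinearOrder (ι × (K ≃ₐ[F₀] K))]
    (e' : Module.Basis (ι × (K ≃ₐ[F₀] K)) K (K ⊗[F₀] V))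
    (E' : Module.Basis (Set.powersetCard (ι × (K ≃ₐ[F₀] K)) n) K (K ⊗[F₀] ⋀[F₀]^n V))
    (Φ' : K ⊗[F₀] ⋀[F₀]^n V ≃ₗ[K] ⋀[K]^n (K ⊗[F₀] V))
    (he2' : ∀ (x : K ≃ₐ[F₀] K) (i : ι) (b : ι → K),
      LinearMap.lTensor K ((ω'.constr K fun i => b i • ω' i).restrictScalars F₀) (e' (i, x)) =
        x (b i) • e' (i, x))
    (hΦ' : ∀ (c : K) (w : Fin n → V),
      Φ' (c ⊗ₜ[F₀] exteriorPower.ιMulti F₀ n w) = c • exteriorPower.ιMulti K n (fun i => (1 : K) ⊗ₜ[F₀] w i))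
    (hE' : ∀ s, Φ' (E' s) = exteriorPower.ιMulti_family K n e' s)
    (WF : Submodule F₀ (⋀[F₀]^n V))
    (hWF : WF.baseChange K =
      Submodule.span K (E' '' {L | ∃ σ : K ≃ₐ[F₀] K, (L : Finset (ι × (K ≃ₐ[F₀] K))) = lineSet σ}))
    (i₀ : ι) (a b : K) (w : ⋀[F₀]^n V) (hw : w ∈ WF) :
    exteriorPower.map n
        ((ω'.constr K fun i => Function.update (fun _ => (1 : K)) i₀ (a + b) i • ω' i).restrictScalars F₀) w =
      exteriorPower.map n
        ((ω'.constr K fun i => Function.update (fun _ => (1 : K)) i₀ a i • ω' i).restrictScalars F₀) w +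
      exteriorPower.map n
        ((ω'.constr K fun i => Function.update (fun _ => (1 : K)) i₀ b i • ω' i).restrictScalars F₀) w :=
  weil_act_add_of_mem_of_le_kunneth n ω' i₀ WF (weil_line_le_kunneth hn ω' e' E' Φ' he2' hΦ' hE' WF hWF) a b w hw

end Combined

end HodgeRepro.Tier3
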